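import Summits.NavierStokesRegularity.NavierStokesRegularity.Theorems.ExtremiserTransienceAveragedRungSlab
import Summits.NavierStokesRegularity.NavierStokesRegularity.Theorems.TypeICertificateLadderTargetStrainCubeSharpDepletion
import Summits.NavierStokesRegularity.NavierStokesRegularity.Theorems.TypeICertificateLadderTargetStrainCubeCeiling
import HarnessLib

/-!
# Route `ExtremiserTransience`, crux `NearExtremalTransience` (stmt-NavierStokesRegularity-21883):
# TIGHTNESS — the crux holds verbatim at `θ = 1`; its whole content is the strict inequality `θ < 1`

`--supports stmt-NavierStokesRegularity-21883` (frame / tightness lemmas for the crux and for the registered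
dynamic stub `stub_blockSubextremal` of the BC3 birth skeleton). Author: prover seat `ns-et-p1-g0`.

* `DepletionLadder.flowwise_of_universal` — **every universal depletion constant is a flow-wise coefficient**:
  if `|∫⟪ω, Dv ω⟫| ≤ κ·M·‖ω‖₂·‖∇ω‖₂` on the admissible class of `StrainCube.universal_depletion_constant_gt`
  (`C^∞`, divergence free, `|v| ≤ M`, bounded gradient, `D⁰v, D¹v, D²v ∈ L²`), then the slices `u(t)`,
  `t ∈ [0,T)`, of a classical Leray–Hopf rapidly-decaying-datum solution on `[0,T)` obey it (they are admissible
  by the landed Tao cover `RungReynoldsOne.stub_taoCover` + Sobolev embedding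
  `exists_forall_norm_fderiv_le_of_hasBoundedSobolevNormsOn`; the pattern of
  `StrainCube.hasSmoothExtensionPast_of_rate_lt_sharp`, stated once for an arbitrary universal `κ`).
* `DepletionLadder.integral_const_div_sub`, `DepletionLadder.integral_const_div_sub_block` — the log-time
  mass of a constant: `∫_{t₁}^{t} c/(T−τ) dτ = c·log((T−t₁)/(T−t))`, and `= c` on each unit log-block
  `[T − (T−t₁)e^{−n}, T − (T−t₁)e^{−(n+1)}]`.
* `nearExtremalTransience_body_one` — **the matrix of `NearExtremalTransience` with `θ = 1` is a THEOREM**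
  (even without the Type-I rate and the non-extension hypotheses): onset `t₁ = 0`, constant coefficient
  `k ≡ min κ ((2+√3)/9) ∈ (11/400, 1)` (both are universal constants: the hypothesis and
  `StrainCube.sharp_constant_is_universal`), `B = 0`, and `∫_{0}^{t} k²/(T−τ) = k² log(T/(T−t)) ≤ κ² log(T/(T−t))`.
* `stub_blockSubextremal_body_one` — likewise the matrix of the registered dynamic stub with `θ₀ = 1`
  (per-unit-log-block quadratic mean `k² ≤ κ²`).

So the crux (and its dynamic stub) is EXACTLY the improvement `θ < 1` of the log-time quadratic mean over the
constant-form bookkeeping — the «structure of near-extremisers» input the route header names; nothing in the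
shape of the conclusion (measurability, `k ∈ [0,1]`, the flow-wise clause for every bound `M`, interval
integrability, the additive constant `B`) carries any difficulty. WHAT THIS IS NOT: no `θ < 1` is proved; no
depletion beyond the landed constants; nothing about Navier–Stokes regularity is settled (the crux, the route
and the summit stay open). [folklore]
-/

noncomputable section

open Set Filter Topology MeasureTheory
open scoped InnerProductSpace RealInnerProductSpace ENNReal NNReal ContDiff
open Literature.Analysis.FluidPDE

namespace Summit.NavierStokesRegularity.NavierStokesRegularity.Theorems

-- the problem directory repeats the summit name (`NavierStokesRegularity/NavierStokesRegularity`)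
set_option linter.dupNamespace false

namespace DepletionLadder

open Summit.NavierStokesRegularity.NavierStokesRegularity.Theorems.RungReynoldsOne

/-- **Every universal depletion constant is a flow-wise (constant) coefficient along a classical
Leray–Hopf rapidly-decaying-datum flow.** If `κ` satisfies the depletion inequality on the admissible class
(`C^∞`, divergence free, bounded with bounded gradient, `D⁰v, D¹v, D²v ∈ L²`), then for every `t ∈ [0,T)` and
every bound `M` of `|u(t)|`: `|∫⟪ω(t), Du(t) ω(t)⟫| ≤ κ·M·‖ω(t)‖₂·‖∇ω(t)‖₂` — the slice `u(t)` is admissible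
(Tao cover on `[0, (t+T)/2]`: all Sobolev norms bounded, gradient bounded by Sobolev embedding). [folklore] -/
theorem flowwise_of_universal {κ ν T : ℝ}
    (hκ : ∀ (v : EuclideanSpace ℝ (Fin 3) → EuclideanSpace ℝ (Fin 3)) (M B : ℝ),
      ContDiff ℝ (⊤ : ℕ∞) v → VectorCalculus.IsDivFree v → (∀ x, ‖v x‖ ≤ M) → (∀ x, ‖fderiv ℝ v x‖ ≤ B) →
      (∫⁻ x, ‖iteratedFDeriv ℝ 0 v x‖ₑ ^ 2 < ⊤) → (∫⁻ x, ‖iteratedFDeriv ℝ 1 v x‖ₑ ^ 2 < ⊤) →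
      (∫⁻ x, ‖iteratedFDeriv ℝ 2 v x‖ₑ ^ 2 < ⊤) →
      |∫ x, ⟪curl v x, fderiv ℝ v x (curl v x)⟫_ℝ| ≤
        κ * M * Real.sqrt (∫ x, ‖curl v x‖ ^ 2) * Real.sqrt (∫ x, frobeniusNormSq (fderiv ℝ (curl v) x)))
    (hν : 0 < ν) (hT : 0 < T)
    {u : ℝ → EuclideanSpace ℝ (Fin 3) → EuclideanSpace ℝ (Fin 3)}
    {p : ℝ → EuclideanSpace ℝ (Fin 3) → ℝ}
    (hsol : IsClassicalNSSolutionOn (Ico 0 T) ν 0 u p) (hLH : IsLerayHopfOn T ν 0 (u 0) u)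
    (hdec : HasRapidSpatialDecay (u 0)) :
    ∀ t ∈ Ico 0 T, ∀ M : ℝ, (∀ x, ‖u t x‖ ≤ M) →
      |∫ x, ⟪curl (u t) x, fderiv ℝ (u t) x (curl (u t) x)⟫_ℝ| ≤
        κ * M * Real.sqrt (∫ x, ‖curl (u t) x‖ ^ 2) *
          Real.sqrt (∫ x, frobeniusNormSq (fderiv ℝ (curl (u t)) x)) := by
  intro t ht M hM
  have ht' : (t + T) / 2 ∈ Ioo 0 T := ⟨by linarith [ht.1], by linarith [ht.2]⟩
  obtain ⟨q, hsolt, hut, -, -⟩ := stub_taoCover hν hT hsol hLH hdec ht'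
  have htI : t ∈ Icc 0 ((t + T) / 2) := ⟨ht.1, by linarith [ht.2]⟩
  obtain ⟨C₀, hC₀⟩ := hut 0
  obtain ⟨C₁, hC₁⟩ := hut 1
  obtain ⟨C₂, hC₂⟩ := hut 2
  obtain ⟨B₁, -, hB₁⟩ := exists_forall_norm_fderiv_le_of_hasBoundedSobolevNormsOn
    (fun s hs => (hsolt.contDiff_velocity hs).of_le (by norm_cast)) hut
  have h0 : ∫⁻ x, ‖iteratedFDeriv ℝ 0 (u t) x‖ₑ ^ 2 < ⊤ := (hC₀ t htI).trans_lt ENNReal.coe_lt_top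
  have h1 : ∫⁻ x, ‖iteratedFDeriv ℝ 1 (u t) x‖ₑ ^ 2 < ⊤ := (hC₁ t htI).trans_lt ENNReal.coe_lt_top
  have h2 : ∫⁻ x, ‖iteratedFDeriv ℝ 2 (u t) x‖ₑ ^ 2 < ⊤ := (hC₂ t htI).trans_lt ENNReal.coe_lt_top
  exact hκ (u t) M B₁ (hsol.contDiff_velocity ht) (hsol.divFree t ht) hM (hB₁ t htI) h0 h1 h2

/-- **Log-time mass of a constant**: `∫_{t₁}^{t} c/(T−τ) dτ = c·log((T−t₁)/(T−t))` for `t₁ ≤ t < T`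
(substitute `σ = T − τ`, `∫ σ⁻¹ = log`). [folklore] -/
theorem integral_const_div_sub {c T t₁ t : ℝ} (h₁ : t₁ ≤ t) (ht : t < T) :
    ∫ τ in t₁..t, c / (T - τ) = c * Real.log ((T - t₁) / (T - t)) := by
  have h : ∫ τ in t₁..t, (T - τ)⁻¹ = Real.log ((T - t₁) / (T - t)) := by
    rw [intervalIntegral.integral_comp_sub_left (fun x => x⁻¹) T,
      integral_inv_of_pos (by linarith) (by linarith)]
  calc ∫ τ in t₁..t, c / (T - τ) = ∫ τ in t₁..t, c * (T - τ)⁻¹ := by simp_rw [div_eq_mul_inv]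
    _ = c * Real.log ((T - t₁) / (T - t)) := by rw [intervalIntegral.integral_const_mul, h]

/-- **Each unit log-block carries mass one**: with `s n = T − (T−t₁)e^{−n}` (`t₁ < T`),
`∫_{s n}^{s (n+1)} c/(T−τ) dτ = c` (`log(e^{−n}/e^{−(n+1)}) = 1`). [folklore] -/
theorem integral_const_div_sub_block {c T t₁ : ℝ} (h₁ : t₁ < T) (n : ℕ) :
    ∫ τ in (T - (T - t₁) * Real.exp (-(n : ℝ)))..(T - (T - t₁) * Real.exp (-((n : ℝ) + 1))),
      c / (T - τ) = c := by
  have hTt₁ : 0 < T - t₁ := sub_pos.2 h₁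
  have hle : T - (T - t₁) * Real.exp (-(n : ℝ)) ≤ T - (T - t₁) * Real.exp (-((n : ℝ) + 1)) := by
    have : Real.exp (-((n : ℝ) + 1)) ≤ Real.exp (-(n : ℝ)) := Real.exp_le_exp.2 (by linarith)
    nlinarith
  have hlt : T - (T - t₁) * Real.exp (-((n : ℝ) + 1)) < T := by
    have : 0 < (T - t₁) * Real.exp (-((n : ℝ) + 1)) := mul_pos hTt₁ (Real.exp_pos _)
    linarith
  rw [integral_const_div_sub hle hlt]
  have hq : (T - (T - (T - t₁) * Real.exp (-(n : ℝ)))) / (T - (T - (T - t₁) * Real.exp (-((n : ℝ) + 1))))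
      = Real.exp 1 := by
    have e1 : T - (T - (T - t₁) * Real.exp (-(n : ℝ))) = (T - t₁) * Real.exp (-(n : ℝ)) := by ring
    have e2 : T - (T - (T - t₁) * Real.exp (-((n : ℝ) + 1))) = (T - t₁) * Real.exp (-((n : ℝ) + 1)) := by
      ring
    rw [e1, e2, mul_div_mul_left _ _ hTt₁.ne', ← Real.exp_sub]
    congr 1; ring
  rw [hq, Real.log_exp, mul_one]

/-- Numerical fact: the landed universal constant `(2+√3)/9` is `< 1` (`√3 < 7`). [folklore] -/
theorem sharp_constant_lt_one : (2 + Real.sqrt 3) / 9 < 1 := by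
  have h3 : Real.sqrt 3 < 2 := by
    rw [Real.sqrt_lt' (by norm_num)]; norm_num
  linarith

end DepletionLadder

open DepletionLadder

/-- **TIGHTNESS OF THE CRUX: the matrix of `NearExtremalTransience` at `θ = 1` is a theorem.** For every
universal depletion constant `κ` (the `κ`-premise of the crux, verbatim) and every classical Leray–Hopf
rapidly-decaying-datum solution on `[0,T)` — the eventual Type-I rate and the non-extension hypotheses of the
crux are accepted and NOT used — there are an onset (`t₁ = 0`), a measurable flow-wise depletion coefficient
`k : ℝ → [0,1]` (the constant `min κ ((2+√3)/9)`, a universal constant `≤ κ`, positive by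
`StrainCube.universal_depletion_constant_gt`, `< 1` by `sharp_constant_lt_one`) and `B = 0` with
`∫_{t₁}^t k²/(T−τ) ≤ (1·κ)² log((T−t₁)/(T−t)) + B` on `[t₁,T)`. Hence the crux
stmt-NavierStokesRegularity-21883 is exactly the assertion that `θ = 1` can be replaced by a universal `θ < 1`:
the log-time quadratic mean of the stretching efficiency of Type-I singular flows stays a definite factor below
every universal constant. [folklore] -/
theorem nearExtremalTransience_body_one :
    ∀ κ : ℝ, (∀ (v : EuclideanSpace ℝ (Fin 3) → EuclideanSpace ℝ (Fin 3)) (M B : ℝ), ContDiff ℝ (⊤ : ℕ∞) v → Literature.Analysis.FluidPDE.VectorCalculus.IsDivFree v → (∀ x, ‖v x‖ ≤ M) → (∀ x, ‖fderiv ℝ v x‖ ≤ B) → (∫⁻ x, ‖iteratedFDeriv ℝ 0 v x‖ₑ ^ 2 < ⊤) → (∫⁻ x, ‖iteratedFDeriv ℝ 1 v x‖ₑ ^ 2 < ⊤) → (∫⁻ x, ‖iteratedFDeriv ℝ 2 v x‖ₑ ^ 2 < ⊤) → |∫ x, ⟪Literature.Analysis.FluidPDE.curl v x, fderiv ℝ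 v x (Literature.Analysis.FluidPDE.curl v x)⟫_ℝ| ≤ κ * M * Real.sqrt (∫ x, ‖Literature.Analysis.FluidPDE.curl v x‖ ^ 2) * Real.sqrt (∫ x, Literature.Analysis.FluidPDE.frobeniusNormSq (fderiv ℝ (Literature.Analysis.FluidPDE.curl v) x))) → ∀ (C ν T : ℝ), 0 < C → 0 < ν → 0 < T → ∀ (u : ℝ → EuclideanSpace ℝ (Fin 3) → EuclideanSpace ℝ (Fin 3)) (p : ℝ → EuclideanSpace ℝ (Fin 3) → ℝ), Literature.Analysis.FluidPDE.IsClassicalNSSolutionOn (Set.Ico 0 T) ν 0 u p → Literature.Analysis.FluidPDE.IsLerayHopfOn T ν 0 (u 0) u → Literature.Analysis.FluidPDE.HasRapidSpatialDecay (u 0) → (∀ᶠ t in 𝓝[<] T, ∀ x, Real.sqrt (T - t) * ‖u t x‖ ≤ C * Real.sqrt ν) → ¬ Literature.Analysis.FluidPDE.HasSmoothExtensionPast ν 0 u T → ∃ t₁ ∈ Set.Ico 0 T, ∃ (k : ℝ → ℝ) (B : ℝ), Measurable k ∧ (∀ τ, 0 ≤ k τ ∧ k τ ≤ 1) ∧ (∀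 t ∈ Set.Ico t₁ T, ∀ M : ℝ, (∀ x, ‖u t x‖ ≤ M) → |∫ x, ⟪Literature.Analysis.FluidPDE.curl (u t) x, fderiv ℝ (u t) x (Literature.Analysis.FluidPDE.curl (u t) x)⟫_ℝ| ≤ k t * M * Real.sqrt (∫ x, ‖Literature.Analysis.FluidPDE.curl (u t) x‖ ^ 2) * Real.sqrt (∫ x, Literature.Analysis.FluidPDE.frobeniusNormSq (fderiv ℝ (Literature.Analysis.FluidPDE.curl (u t)) x))) ∧ (∀ t ∈ Set.Ico t₁ T, ∫ τ in t₁..t, k τ ^ 2 / (T - τ) ≤ (1 * κ) ^ 2 * Real.log ((T - t₁) / (T - t)) + B) := by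
  intro κ hκ C ν T _ hν hT u p hsol hLH hdec _ _
  have hκpos : 0 < κ := lt_trans (by norm_num) (StrainCube.universal_depletion_constant_gt hκ)
  have hS0 : 0 < (2 + Real.sqrt 3) / 9 := by positivity
  set c : ℝ := min κ ((2 + Real.sqrt 3) / 9) with hc
  have hc0 : 0 ≤ c := le_min hκpos.le hS0.le
  have hc1 : c ≤ 1 := (min_le_right _ _).trans sharp_constant_lt_one.le
  have hcκ : c ≤ κ := min_le_left _ _
  have hflow : ∀ t ∈ Ico 0 T, ∀ M : ℝ, (∀ x, ‖u t x‖ ≤ M) →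
      |∫ x, ⟪curl (u t) x, fderiv ℝ (u t) x (curl (u t) x)⟫_ℝ| ≤
        c * M * Real.sqrt (∫ x, ‖curl (u t) x‖ ^ 2) *
          Real.sqrt (∫ x, frobeniusNormSq (fderiv ℝ (curl (u t)) x)) := by
    rcases min_choice κ ((2 + Real.sqrt 3) / 9) with h | h <;> rw [hc, h]
    · exact flowwise_of_universal hκ hν hT hsol hLH hdec
    · exact flowwise_of_universal StrainCube.sharp_constant_is_universal hν hT hsol hLH hdec
  refine ⟨0, ⟨le_rfl, hT⟩, fun _ => c, 0, measurable_const, fun _ => ⟨hc0, hc1⟩, hflow, ?_⟩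
  intro t ht
  rw [integral_const_div_sub ht.1 ht.2, add_zero, one_mul]
  have hlog : 0 ≤ Real.log ((T - 0) / (T - t)) :=
    Real.log_nonneg ((one_le_div (sub_pos.2 ht.2)).2 (by linarith [ht.1]))
  exact mul_le_mul_of_nonneg_right (pow_le_pow_left₀ hc0 hcκ 2) hlog

/-- **TIGHTNESS OF THE DYNAMIC STUB: the matrix of `stub_blockSubextremal` (BC3 birth skeleton of the crux,
registered on stmt-NavierStokesRegularity-21883) at `θ₀ = 1` is a theorem** — same witnesses (`t₁ = 0`,
`k ≡ min κ ((2+√3)/9)`): the weight `k²/(T−τ)` is interval-integrable on every `[t₁,t]`, `t < T`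
(`intervalIntegrable_coeff_sq_div`), and its integral over each unit log-block is `k² ≤ κ²`
(`integral_const_div_sub_block`). The stub's content is `θ₀ < 1`. [folklore] -/
theorem stub_blockSubextremal_body_one :
    ∀ κ : ℝ, (∀ (v : EuclideanSpace ℝ (Fin 3) → EuclideanSpace ℝ (Fin 3)) (M B : ℝ), ContDiff ℝ (⊤ : ℕ∞) v → Literature.Analysis.FluidPDE.VectorCalculus.IsDivFree v → (∀ x, ‖v x‖ ≤ M) → (∀ x, ‖fderiv ℝ v x‖ ≤ B) → (∫⁻ x, ‖iteratedFDeriv ℝ 0 v x‖ₑ ^ 2 < ⊤) → (∫⁻ x, ‖iteratedFDeriv ℝ 1 v x‖ₑ ^ 2 < ⊤) → (∫⁻ x, ‖iteratedFDeriv ℝ 2 v x‖ₑ ^ 2 < ⊤) → |∫ x, ⟪Literature.Analysis.FluidPDE.curl v x, fderiv ℝ v x (Literature.Analysis.FluidPDE.curl v x)⟫_ℝ| ≤ κ * M * Real.sqrt (∫ x, ‖Literature.Analysis.FluidPDE.curl v x‖ ^ 2) * Real.sqrt (∫ x, Literature.Analysis.FluidPDE.frobeniusNormSq (fderiv ℝ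 (Literature.Analysis.FluidPDE.curl v) x))) → ∀ (C ν T : ℝ), 0 < C → 0 < ν → 0 < T → ∀ (u : ℝ → EuclideanSpace ℝ (Fin 3) → EuclideanSpace ℝ (Fin 3)) (p : ℝ → EuclideanSpace ℝ (Fin 3) → ℝ), Literature.Analysis.FluidPDE.IsClassicalNSSolutionOn (Set.Ico 0 T) ν 0 u p → Literature.Analysis.FluidPDE.IsLerayHopfOn T ν 0 (u 0) u → Literature.Analysis.FluidPDE.HasRapidSpatialDecay (u 0) → (∀ᶠ t in 𝓝[<] T, ∀ x, Real.sqrt (T - t) * ‖u t x‖ ≤ C * Real.sqrt ν) → ¬ Literature.Analysis.FluidPDE.HasSmoothExtensionPast ν 0 u T → ∃ t₁ ∈ Set.Ico 0 T, ∃ (k : ℝ → ℝ), Measurable k ∧ (∀ τ, 0 ≤ k τ ∧ k τ ≤ 1) ∧ (∀ t ∈ Set.Ico t₁ T, ∀ M : ℝ, (∀ x, ‖u t x‖ ≤ M) → |∫ x, ⟪Literature.Analysis.FluidPDE.curl (u t) x, fderiv ℝ (u t) x (Literature.Analysis.FluidPDE.curl (u t) x)⟫_ℝ| ≤ k t * M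 * Real.sqrt (∫ x, ‖Literature.Analysis.FluidPDE.curl (u t) x‖ ^ 2) * Real.sqrt (∫ x, Literature.Analysis.FluidPDE.frobeniusNormSq (fderiv ℝ (Literature.Analysis.FluidPDE.curl (u t)) x))) ∧ (∀ t ∈ Set.Ico t₁ T, IntervalIntegrable (fun τ => k τ ^ 2 / (T - τ)) MeasureTheory.volume t₁ t) ∧ (∀ n : ℕ, ∫ τ in (T - (T - t₁) * Real.exp (-(n : ℝ)))..(T - (T - t₁) * Real.exp (-((n : ℝ) + 1))), k τ ^ 2 / (T - τ) ≤ (1 * κ) ^ 2) := by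
  intro κ hκ C ν T _ hν hT u p hsol hLH hdec _ _
  have hκpos : 0 < κ := lt_trans (by norm_num) (StrainCube.universal_depletion_constant_gt hκ)
  have hS0 : 0 < (2 + Real.sqrt 3) / 9 := by positivity
  set c : ℝ := min κ ((2 + Real.sqrt 3) / 9) with hc
  have hc0 : 0 ≤ c := le_min hκpos.le hS0.le
  have hc1 : c ≤ 1 := (min_le_right _ _).trans sharp_constant_lt_one.le
  have hcκ : c ≤ κ := min_le_left _ _
  have hflow : ∀ t ∈ Ico 0 T, ∀ M : ℝ, (∀ x, ‖u t x‖ ≤ M) →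
      |∫ x, ⟪curl (u t) x, fderiv ℝ (u t) x (curl (u t) x)⟫_ℝ| ≤
        c * M * Real.sqrt (∫ x, ‖curl (u t) x‖ ^ 2) *
          Real.sqrt (∫ x, frobeniusNormSq (fderiv ℝ (curl (u t)) x)) := by
    rcases min_choice κ ((2 + Real.sqrt 3) / 9) with h | h <;> rw [hc, h]
    · exact flowwise_of_universal hκ hν hT hsol hLH hdec
    · exact flowwise_of_universal StrainCube.sharp_constant_is_universal hν hT hsol hLH hdec
  have hk01 : ∀ τ : ℝ, 0 ≤ (fun _ : ℝ => c) τ ∧ (fun _ : ℝ => c) τ ≤ 1 := fun _ => ⟨hc0, hc1⟩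
  refine ⟨0, ⟨le_rfl, hT⟩, fun _ => c, measurable_const, hk01, hflow, ?_, ?_⟩
  · intro t ht
    exact intervalIntegrable_coeff_sq_div measurable_const hk01 ht.1 ht.2
  · intro n
    rw [integral_const_div_sub_block hT n, one_mul]
    exact pow_le_pow_left₀ hc0 hcκ 2

end Summit.NavierStokesRegularity.NavierStokesRegularity.Theorems

end
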